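import Literature.Geometry.Lorentzian.FinalState
import Literature.Geometry.Lorentzian.Genericity
import Summits.FinalStateConjecture.FinalStateConjecture.Theorems.PhotonSphereChannelsTameCensorshipSmoothDataFamilyTimeReverse
import Summits.FinalStateConjecture.FinalStateConjecture.Theorems.PhotonSphereChannelsTameCensorshipTimeReverseAdmissible
import HarnessLib

/-!
# Route PhotonSphereChannels · crux `TameCensorship` (stmt-FinalStateConjecture-17431) · line `Sketch`, skeleton v8 ·
# stub `stub_probeTransport`: the data involution (h,k) ↦ (h,−k) carries probes to probes (def-free, abstract in r)

Helper file (`--supports stmt-FinalStateConjecture-17431`) of line `Sketch` (lead c4, 2026-08-17): one brick of the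
def-free TRANSPORT PACKAGE of the robust legend (robust escapability of a property `Q` of initial data at a datum `d`:
every compactly supported smooth admissible probe through `d` enriches, along an injective linear map of parameter
spaces, to one along all of whose further enrichments an open dense set of radial directions has `Q` for all small
non-zero parameters). A PROBE through a datum `d` is a jointly smooth (`InitialDataSet.IsSmoothDataFamily`,
`Genericity.lean`) family `G : ℝᵐ → InitialDataSet (𝓡 3) X` of ADMISSIBLE vacuum data (`admissibleVacuumData X`,
`FinalState.lean`) with `G 0 = d`, agreeing with `d` in `h` and `k` off one compact set `K`. This file shows that any
self-map `r` of the data type with `(r D).h = D.h` and `(r D).k = −D.k` pointwise (abstractly: the time-reversal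
involution) carries probes through `d` to probes through `r d`, with the same parameter space and the same `K`:
joint smoothness of `r ∘ G` is `stub_isSmoothDataFamily_timeReverse` (…SmoothDataFamilyTimeReverse), admissibility of
each `r (G c)` is `stub_timeReverse_admissible` (…TimeReverseAdmissible), and the agreement off `K` is rewriting with
the two defining identities of `r`. Folklore bookkeeping; nothing analytic is claimed here.
Stub-worker of the line lead prover-line-stmt-FinalStateConjecture-17431-c4-0, 2026-08-17.
-/

set_option linter.dupNamespace false

open Literature.Geometry.Lorentzian
open scoped Manifold ContDiff Topology
open Filter Set Function

noncomputable section

namespace Summit.FinalStateConjecture.FinalStateConjecture.Theorems.PhotonSphereChannels.TameCensorshipUnwind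

/-- **Stub `stub_probeTransport` of line `Sketch` (skeleton v8) for the crux `PhotonSphereChannels.TameCensorship`
(stmt-FinalStateConjecture-17431): a metric-preserving, `k`-negating self-map of the data type carries probes to
probes.** Let `r : InitialDataSet (𝓡 3) X → InitialDataSet (𝓡 3) X` satisfy `(r D).h = D.h` and
`(r D).k x v w = −D.k x v w` for all `D, x, v, w`. If `G : ℝᵐ → InitialDataSet (𝓡 3) X` is a jointly smooth family of
admissible vacuum data with `G 0 = d` which agrees with `d` (in `h.inner` and `k`) off a compact set `K`, then
`c ↦ r (G c)` is a jointly smooth family of admissible vacuum data with `r (G 0) = r d` which agrees with `r d` off the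
SAME `K`. Proof: smoothness is `stub_isSmoothDataFamily_timeReverse` applied to `F = G`, `F' = r ∘ G`; `r (G 0) = r d`
by rewriting `G 0 = d`; admissibility of `r (G c)` is `stub_timeReverse_admissible` applied to `G c`; off `K`,
`(r (G c)).h = (G c).h`, `(r d).h = d.h` and `(G c).h.inner x = d.h.inner x`, while for the continuous bilinear forms
`(r (G c)).k x`, `(r d).k x` one tests on `v, w` and rewrites both sides to `−(G c).k x v w = −d.k x v w`. [folklore] -/
theorem stub_probeTransport :
    ∀ (X : Type) [TopologicalSpace X] [ChartedSpace E3 X] [IsManifold (𝓡 3) ∞ X] [T2Space X]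
    [SecondCountableTopology X] [ConnectedSpace X] (r : InitialDataSet (𝓡 3) X → InitialDataSet (𝓡 3) X), (∀ D,
    (r D).h = D.h) → (∀ (D : InitialDataSet (𝓡 3) X) (x : X) (v w : TangentSpace (𝓡 3) x), (r D).k x v w = -D.k
    x v w) → ∀ (d : InitialDataSet (𝓡 3) X) (m : ℕ) (G : EuclideanSpace ℝ (Fin m) → InitialDataSet (𝓡 3) X),
    (InitialDataSet.IsSmoothDataFamily m G ∧ G 0 = d ∧ (∀ c, G c ∈ admissibleVacuumData X) ∧ ∃ K : Set X,
    IsCompact K ∧ ∀ c, ∀ x ∉ K, (G c).h.inner x = d.h.inner x ∧ (G c).k x = d.k x) →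
    (InitialDataSet.IsSmoothDataFamily m (fun c => r (G c)) ∧ r (G 0) = r d ∧ (∀ c, r (G c) ∈
    admissibleVacuumData X) ∧ ∃ K : Set X, IsCompact K ∧ ∀ c, ∀ x ∉ K, (r (G c)).h.inner x = (r d).h.inner x ∧
    (r (G c)).k x = (r d).k x) := by
  intro X _ _ _ _ _ _ r hh hk d m G hG
  obtain ⟨hs, h0, hadm, K, hK, hGK⟩ := hG
  refine ⟨stub_isSmoothDataFamily_timeReverse X m G _ (fun c => hh (G c)) (fun c x v w => hk (G c) x v w) hs,
    by rw [h0], fun c => stub_timeReverse_admissible X (G c) (r (G c)) (hh (G c)) (fun x v w => hk (G c) x v w)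
    (hadm c), K, hK, fun c x hx => ?_⟩
  obtain ⟨hh', hk'⟩ := hGK c x hx
  refine ⟨?_, ?_⟩
  · rw [hh, hh]
    exact hh'
  · ext v w
    rw [hk, hk, hk']

end Summit.FinalStateConjecture.FinalStateConjecture.Theorems.PhotonSphereChannels.TameCensorshipUnwind

end
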